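import Summits.AtomisticToContinuum.Crystallization.Theses.ChessboardParticlePlanes

/-!
# Crux `ChessboardParticlePlanes.LjPlaneChessboard` (stmt-AtomisticToContinuum-6709), line `Sketch`,
# stub `stub_adjacentHeights` — adjacent occupied heights of a layer-confined configuration

Let `Q` be a periodic configuration of `ℝ³` whose periods `g ∈ G = Q.lattice` have heights (third
coordinates) `g 2 ∈ c₀ℤ`, where `c₀ > 0` is itself the height of a period `w`.  Then every OCCUPIED
height `t` (`t = x 2` for a point `x` of `Q`) has a NEXT occupied height `τu t > t` and a PREVIOUS
occupied height `τd t < t`, with no occupied height strictly in between.  [folklore]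

PROOF.  A point of `Q` is `y + g` with `y` in the (finite) motif `F` and `g` a period, so its height
`y 2 + g 2` lies in the coset `y 2 + c₀ℤ`; for fixed `y` only the finitely many `k : ℤ` between
`⌈(a - y 2)/c₀⌉` and `⌊(b - y 2)/c₀⌋` give a height `y 2 + c₀ k ∈ [a, b]`, hence only finitely many
occupied heights lie in any bounded interval `[a, b]` (`adjacentHeights_finite`).  Translating a
point at height `t` by the periods `± w` gives points at heights `t ± c₀`, so the sets
`A = O ∩ (t, t + c₀]` and `B = O ∩ [t - c₀, t)` (`O` = occupied heights) are finite and non-empty;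
`τu t = min A = sInf A` and `τd t = max B = sSup B` do the job: an occupied height `s > t` is either
`≤ t + c₀`, hence in `A` and `≥ min A`, or `> t + c₀ ≥ τu t`; symmetrically below `t`.
-/

noncomputable section

namespace Summit.AtomisticToContinuum.Crystallization.Theorems.ChessboardParticlePlanesLjPlaneChessboard

open Literature.MathematicalPhysics.StatisticalMechanics

/-- If the periods of a periodic configuration `Q` of `ℝ³` have heights in `c₀ℤ` (`c₀ > 0`), then
only finitely many occupied heights lie in a bounded interval `[a, b]`: the occupied heights lie in
the finitely many cosets `y 2 + c₀ℤ`, `y` in the motif, and each coset meets `[a, b]` in the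
finitely many points `y 2 + c₀ k`, `⌈(a - y 2)/c₀⌉ ≤ k ≤ ⌊(b - y 2)/c₀⌋`. [folklore] -/
theorem adjacentHeights_finite (Q : PeriodicConfiguration 3) {c₀ : ℝ} (hc₀ : 0 < c₀)
    (hG : ∀ g ∈ Q.lattice, ∃ k : ℤ, g 2 = c₀ * k) (a b : ℝ) :
    {s : ℝ | (∃ x ∈ Q.points, x 2 = s) ∧ a ≤ s ∧ s ≤ b}.Finite := by
  -- for each base height `r`, only finitely many `k : ℤ` have `a ≤ r + c₀ k ≤ b`
  have hfin : ∀ r : ℝ, {k : ℤ | a ≤ r + c₀ * k ∧ r + c₀ * k ≤ b}.Finite := by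
    intro r
    refine (Set.finite_Icc ⌈(a - r) / c₀⌉ ⌊(b - r) / c₀⌋).subset ?_
    rintro k ⟨hk₁, hk₂⟩
    refine ⟨Int.ceil_le.2 ?_, Int.le_floor.2 ?_⟩
    · rw [div_le_iff₀ hc₀]
      linarith
    · rw [le_div_iff₀ hc₀]
      linarith
  -- the occupied heights in `[a, b]` lie in the union over the motif of the images of these `k`
  refine (Q.motif.finite_toSet.biUnion fun y _ =>
    (hfin (y 2)).image fun k : ℤ => y 2 + c₀ * k).subset ?_
  rintro s ⟨⟨x, hx, rfl⟩, has, hsb⟩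
  obtain ⟨y, hy, g, hg, rfl⟩ := hx
  obtain ⟨k, hk⟩ := hG g hg
  have h2 : (y + g) 2 = y 2 + c₀ * k := by rw [PiLp.add_apply, hk]
  rw [h2] at has hsb ⊢
  exact Set.mem_biUnion (Finset.mem_coe.2 hy) ⟨k, ⟨has, hsb⟩, rfl⟩

/-- **Stub 8 — adjacent occupied heights (M).**  If the heights of the periods of `Q` lie in
`c₀ℤ` (`c₀ > 0` the height of a period), then the set of occupied heights
`O = {x 2 | x ∈ Q.points} = ⋃_{y ∈ F} (y 2 + c₀ℤ)` is a finite union of cosets of `c₀ℤ`, hence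
locally finite and unbounded in both directions; so every occupied height `t` has a NEXT occupied
height `τu t > t` and a PREVIOUS one `τd t < t` (nothing occupied strictly in between):
`τu t = min (O ∩ (t, t + c₀])`, `τd t = max (O ∩ [t − c₀, t))`. [folklore] -/
theorem stub_adjacentHeights :
    ∀ Q : PeriodicConfiguration 3,
      (∃ c₀ : ℝ, 0 < c₀ ∧ (∃ g ∈ Q.lattice, g 2 = c₀) ∧ ∀ g ∈ Q.lattice, ∃ k : ℤ, g 2 = c₀ * k) →
      ∃ τu τd : ℝ → ℝ, ∀ t : ℝ, (∃ x ∈ Q.points, x 2 = t) →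
        (t < τu t ∧ (∃ x ∈ Q.points, x 2 = τu t) ∧ (∀ x ∈ Q.points, x 2 ≤ t ∨ τu t ≤ x 2)) ∧
        (τd t < t ∧ (∃ x ∈ Q.points, x 2 = τd t) ∧ (∀ x ∈ Q.points, x 2 ≤ τd t ∨ t ≤ x 2)) := by
  rintro Q ⟨c₀, hc₀, ⟨w, hw, hw2⟩, hG⟩
  -- translating a point by the periods `± w` shifts its height by `± c₀`
  have hup : ∀ s : ℝ, (∃ x ∈ Q.points, x 2 = s) → ∃ x ∈ Q.points, x 2 = s + c₀ := by
    rintro s ⟨x, hx, rfl⟩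
    exact ⟨x + w, Q.add_mem_points hx hw, by rw [PiLp.add_apply, hw2]⟩
  have hdown : ∀ s : ℝ, (∃ x ∈ Q.points, x 2 = s) → ∃ x ∈ Q.points, x 2 = s - c₀ := by
    rintro s ⟨x, hx, rfl⟩
    refine ⟨x + -w, Q.add_mem_points hx (Q.lattice.neg_mem hw), ?_⟩
    rw [PiLp.add_apply, PiLp.neg_apply, hw2, sub_eq_add_neg]
  -- `τu t = min (O ∩ (t, t + c₀])`, `τd t = max (O ∩ [t - c₀, t))`
  refine ⟨fun t => sInf {s : ℝ | (∃ x ∈ Q.points, x 2 = s) ∧ t < s ∧ s ≤ t + c₀},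
    fun t => sSup {s : ℝ | (∃ x ∈ Q.points, x 2 = s) ∧ t - c₀ ≤ s ∧ s < t}, fun t ht => ⟨?_, ?_⟩⟩
  · -- the next occupied height above `t`
    have hAfin : {s : ℝ | (∃ x ∈ Q.points, x 2 = s) ∧ t < s ∧ s ≤ t + c₀}.Finite :=
      (adjacentHeights_finite Q hc₀ hG t (t + c₀)).subset fun s hs => ⟨hs.1, hs.2.1.le, hs.2.2⟩
    have hAne : {s : ℝ | (∃ x ∈ Q.points, x 2 = s) ∧ t < s ∧ s ≤ t + c₀}.Nonempty :=
      ⟨t + c₀, hup t ht, by linarith, le_rfl⟩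
    have hmem := hAne.csInf_mem hAfin
    refine ⟨hmem.2.1, hmem.1, fun x hx => ?_⟩
    rcases le_or_gt (x 2) t with h | h
    · exact Or.inl h
    · refine Or.inr ?_
      rcases le_or_gt (x 2) (t + c₀) with h' | h'
      · exact csInf_le hAfin.bddBelow ⟨⟨x, hx, rfl⟩, h, h'⟩
      · exact hmem.2.2.trans h'.le
  · -- the previous occupied height below `t`
    have hBfin : {s : ℝ | (∃ x ∈ Q.points, x 2 = s) ∧ t - c₀ ≤ s ∧ s < t}.Finite :=
      (adjacentHeights_finite Q hc₀ hG (t - c₀) t).subset fun s hs => ⟨hs.1, hs.2.1, hs.2.2.le⟩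
    have hBne : {s : ℝ | (∃ x ∈ Q.points, x 2 = s) ∧ t - c₀ ≤ s ∧ s < t}.Nonempty :=
      ⟨t - c₀, hdown t ht, le_rfl, by linarith⟩
    have hmem := hBne.csSup_mem hBfin
    refine ⟨hmem.2.2, hmem.1, fun x hx => ?_⟩
    rcases le_or_gt t (x 2) with h | h
    · exact Or.inr h
    · refine Or.inl ?_
      rcases le_or_gt (t - c₀) (x 2) with h' | h'
      · exact le_csSup hBfin.bddAbove ⟨⟨x, hx, rfl⟩, h', h⟩
      · exact h'.le.trans hmem.2.1

end Summit.AtomisticToContinuum.Crystallization.Theorems.ChessboardParticlePlanesLjPlaneChessboard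

end
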